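import Summits.BirchSwinnertonDyer.BirchSwinnertonDyer.Theorems.MordellShaFreeCutThreeAdicBDPValueRigidity
import Summits.BirchSwinnertonDyer.BirchSwinnertonDyer.Theorems.MordellShaFreeCutThreeAdicBDPTripleUpTo
import Summits.BirchSwinnertonDyer.BirchSwinnertonDyer.Theorems.CongruentShaFreeCutBDPUpToRigidity
import Summits.BirchSwinnertonDyer.BirchSwinnertonDyer.Theorems.CongruentShaFreeCutCharacterSupply

set_option linter.dupNamespace false
set_option autoImplicit false

/-! # Route `MordellShaFreeCut` (rung S2b) — the ∀-FRAME quantifier of (LB-bdp) costs NOTHING: the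
character supply of the value-at-𝟙 rigidity readings is a TREE THEOREM at `p = 3`
(`CongruentShaFreeCutCharacterSupply.characterSupplyAt`), so the registered ∀-frame stubs
`ThreeAdicBDPValueAtOne` (EXACT, v6bp on stmt-BirchSwinnertonDyer-19159) and `ThreeAdicBDPValueAtOneUpTo`
(the ♯ hedge, p450685) follow from «ONE admissible frame WITH its value at 𝟙 at every `ι'`» ALONE

Cell `bsd-cn100`, prover seat `bsd-cn100-s2b-c3` (g7). Supports, does not close,
stmt-BirchSwinnertonDyer-19160; serves the BDP line of record of the residual 19159. Sibling of
`MordellShaFreeCutThreeAdicBDPValueRigidity.lean` (p478137: the exact reading WITH the supply as a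
hypothesis `hsup`) and of `CongruentShaFreeCutBDPUpToRigidityReadings.lean` (transfer g11: LEMMA R of
MEMO-transfer-13 §5.4 in the ♯ currency, supply as a hypothesis). THE POINT OF THIS FILE: both hypotheses
`hsup` are instances of a theorem the cell landed on 2026-08-26 (transfer g8, the `p = 2` character-supply
port, valid at EVERY prime): `…Theorems.CongruentShaFreeCutCharacterSupply.characterSupplyAt` — for every
imaginary quadratic `K`, `ι : ℚ̄_p ≃ ℂ`, anticyclotomic `κ` with topological generator `γ`, the two
sequences `φ₀^{p^k}`, `φ₀^{2p^k}` of everywhere-unramified interpolation characters with avatars through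
`κ` and values `x₀^{p^k} → 1`, `≠ 1` (x11b3's S24-a λ-supply + multr1's powers, ported to all `p`).
Hence, at `p = 3`:

* `threeAdicBDPValueAtOne_of_frameValue` — **(LB-bdp) ∀-frame EXACT `ThreeAdicBDPValueAtOne` ⟸ the ∃∧
  statement at every `ι'` inducing `v`: ONE admissible `(Ω_K, Ω_p, 𝓛)` WITH
  `𝓛(𝟙) = u·c⁻²·(1 − a₃3⁻¹ + [3 ∤ N]3⁻¹)²·(log_ω P)²`, `u ∈ R₀ˣ`** — NO supply hypothesis
  (`threeAdicBDPValueAtOne_of_frameValue_of_supply` + `characterSupplyAt`);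
* `threeAdicBDPValueAtOneUpTo_of_frameValue` — **(LB-bdp♯) ∀-frame `ThreeAdicBDPValueAtOneUpTo` ⟸ the
  ∃∧♯ statement at every `ι'`: ONE admissible `(Ω_K, Ω_p, C ≠ 0, 𝓛)` WITH `𝓛(𝟙) = u·(…)`, `u ≠ 0`**
  — via transfer g11's LEMMA R `coe_constantCoeff_eq_mul_of_isBDPLFunctionUpTo_of_supply`
  (`[T⁰]𝓛' = (C'/C)·[T⁰]𝓛`) + `characterSupplyAt`; `u' := (C'/C)·u ≠ 0`.

So on BOTH currencies of the S2b BDP road the ∀-frame form of the value statement is EQUIVALENT (given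
frames at every `ι'`) to the one-frame-with-value statement that a construction delivers (Castella 2018
Thm. 3.2 shape; the cell's MEMO-transfer-13 Thm. 13.2 at the additive prime): the ∀-quantifier carries no
research content. HONEST FRAMING: CONDITIONAL reductions over tree theorems; nothing here proves
(LB-exist), (LB-wan), (LB-bdp) (in either currency), crux A, crux B, the leaf, Sylvester's conjecture or
any case of BSD. PARTITION: none — RANK axis.

[cite: Castella2018, Thm. 3.1–3.2 (arXiv:1704.06608 pp. 8–9) (shape only; nothing asserted at 3 ∣ N)]
[cite: BertoliniDarmonPrasanna2013, Thm. 5.13 (shape of the value at the trivial character)]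
[cite: Washington1997, §13.1 (anticyclotomic characters; the supply)] -/

noncomputable section

open scoped Classical Topology

namespace Summit.BirchSwinnertonDyer.BirchSwinnertonDyer.Theorems.MordellShaFreeCutThreeAdicBDPValueRigiditySupplied

open Filter PowerSeries WeierstrassCurve NumberField IsDedekindDomain Field
  Literature.NumberTheory.EllipticCurves Literature.NumberTheory.EllipticCurves.ModularForms
  Literature.NumberTheory.QuadraticFields Literature.NumberTheory.EllipticCurves.Castella2018
open Literature.NumberTheory.GaloisRepresentations Literature.NumberTheory.GaloisCohomology
open Summit.BirchSwinnertonDyer.BirchSwinnertonDyer.Theorems.MordellShaFreeCutThreeAdicBDPTriple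
  (ThreeAdicBDPValueAtOne)
open Summit.BirchSwinnertonDyer.BirchSwinnertonDyer.Theorems.MordellShaFreeCutThreeAdicBDPTripleUpTo
  (ThreeAdicBDPValueAtOneUpTo)
open Summit.BirchSwinnertonDyer.BirchSwinnertonDyer.Theorems.MordellShaFreeCutThreeAdicBDPValueRigidity
  (threeAdicBDPValueAtOne_of_frameValue_of_supply)
open Summit.BirchSwinnertonDyer.BirchSwinnertonDyer.Theorems.CongruentShaFreeCutBDPUpToRigidity
  (coe_constantCoeff_eq_mul_of_isBDPLFunctionUpTo_of_supply)
open Summit.BirchSwinnertonDyer.BirchSwinnertonDyer.Theorems.CongruentShaFreeCutCharacterSupply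
  (characterSupplyAt)

/-! ## 1. The exact currency: `ThreeAdicBDPValueAtOne` from one frame with its value at every `ι'` -/

/-- **(LB-bdp) ∀-frame EXACT `ThreeAdicBDPValueAtOne` ⟸ the one-frame-with-value statement at every `ι'`,
with NO character-supply hypothesis**: `threeAdicBDPValueAtOne_of_frameValue_of_supply` (p478137; X11b's
S27 value-at-𝟙 rigidity `constantCoeff_eq_of_isBDPLFunction_of_supply`) fed with the cell's character-supply
THEOREM `CongruentShaFreeCutCharacterSupply.characterSupplyAt` at `p = 3`. The one-frame statement
(`hEV`, inline: for the registered stub's binders and every `ι'` inducing `v`, SOME admissible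
`(Ω_K, Ω_p, 𝓛)` WITH `𝓛(𝟙) = u·c⁻²·(1 − a₃3⁻¹ + [3 ∤ N]3⁻¹)²·(log_ω P)²`, `u ∈ R₀ˣ`) is a HYPOTHESIS —
what a construction delivers; nothing is asserted at the additive prime `3`.
[cite: Castella2018, Thm. 3.1–3.2 (arXiv:1704.06608 pp. 8–9) (shape only; nothing asserted)]
[cite: Washington1997, §13.1 (the supply)] -/
theorem threeAdicBDPValueAtOne_of_frameValue
    (hEV : ∀ (W : WeierstrassCurve ℚ) [W.IsElliptic] [W.IsGloballyMinimal], W.j = 0 →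
      ∀ (ι' : PadicAlgCl 3 ≃+* ℂ) (K : Type) [Field K] [NumberField K] (N : ℕ) [NeZero N]
        (Dt : ModularParametrizationData W N)
        (H : HeegnerDatum N (NumberField.discr K)) (w : InfinitePlace K) (e : K →+* ℚ_[3])
        (v : HeightOneSpectrum (𝓞 K)) (κ : ZpExtension K 3) (γ : absoluteGaloisGroup K)
        [Fact (κ.IsTopGenerator γ)] (P : (W.baseChange K).toAffine.Point),
      W.conductorNorm ℤ = N → IsImaginaryQuadratic K →
      SatisfiesHeegnerHypothesis N K → ((Ideal.span {(3 : ℤ)}).primesOver (𝓞 K)).ncard = 2 →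
      ((3 : ℕ) : 𝓞 K) ∈ v.asIdeal →
      (∀ (w' : InfinitePlace K) (k : 𝓞 K), k ∈ v.asIdeal ↔ ‖ι'.symm (w'.embedding (k : K))‖ < 1) →
      κ.IsAnticyclotomic →
      WeierstrassCurve.Affine.Point.map w.embedding.toRatAlgHom P = heegnerPointComplex Dt H →
      (∀ k : 𝓞 K, k ∈ v.asIdeal ↔ ‖e (k : K)‖ < 1) →
      ∃ (ΩK : ℂ) (Ωp : (unrIntegers 3)ˣ) (L : UnrSeries 3),
        ΩK ≠ 0 ∧ IsBDPLFunction ι' v κ γ Dt.f ΩK ((Ωp : unrIntegers 3) : ℂ_[3]) L ∧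
        ∃ u : (unrIntegers 3)ˣ, L.HasValueAt 0
          (((u : unrIntegers 3) : ℂ_[3]) *
            algebraMap ℚ_[3] ℂ_[3] (((Dt.c : ℚ_[3])⁻¹) ^ 2 *
              (1 - (W.LFunction 3 : ℚ_[3]) * (3 : ℚ_[3])⁻¹ +
                (if (3 : ℕ) ∣ N then 0 else (3 : ℚ_[3])⁻¹)) ^ 2 *
              (padicLogOmega W 3 e P) ^ 2))) :
    ThreeAdicBDPValueAtOne :=
  threeAdicBDPValueAtOne_of_frameValue_of_supply (characterSupplyAt (p := 3)) hEV

/-! ## 2. The ♯ currency: `ThreeAdicBDPValueAtOneUpTo` from one ♯ frame with its value at every `ι'` -/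

/-- **(LB-bdp♯) ∀-frame `ThreeAdicBDPValueAtOneUpTo` (the S2b hedge, p450685) ⟸ the one-♯-frame-with-value
statement at every `ι'`, with NO character-supply hypothesis**: given the stub's data and an arbitrary
admissible `(Ω_K', Ω_p', C' ≠ 0, 𝓛')`, take the reference ♯ frame `(Ω_K, Ω_p, C ≠ 0, 𝓛)` WITH
`𝓛(𝟙) = u·c⁻²·(1 − a₃3⁻¹ + [3 ∤ N]3⁻¹)²·(log_ω P)²`, `u ≠ 0`, supplied by `hEV` at the same `ι'`; transfer
g11's LEMMA R `coe_constantCoeff_eq_mul_of_isBDPLFunctionUpTo_of_supply` (MEMO-transfer-13 §5.4, ♯ frame,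
any `p`), fed with `characterSupplyAt` at `p = 3`, gives `[T⁰]𝓛' = (C'/C)·[T⁰]𝓛`, so `𝓛'(𝟙)` is the same
display with `u' := (C'/C)·u ≠ 0`. `hEV` (inline) is a HYPOTHESIS; nothing is asserted at `3`.
[cite: Castella2018, Thm. 3.1–3.2 (arXiv:1704.06608 pp. 8–9) (shape only; nothing asserted)]
[cite: CastellaHsieh2018, §3.3, Prop. 3.4, Def. 3.5 and Prop. 3.6 (the constants outside the display)] -/
theorem threeAdicBDPValueAtOneUpTo_of_frameValue
    (hEV : ∀ (W : WeierstrassCurve ℚ) [W.IsElliptic] [W.IsGloballyMinimal], W.j = 0 →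
      ∀ (ι' : PadicAlgCl 3 ≃+* ℂ) (K : Type) [Field K] [NumberField K] (N : ℕ) [NeZero N]
        (Dt : ModularParametrizationData W N)
        (H : HeegnerDatum N (NumberField.discr K)) (w : InfinitePlace K) (e : K →+* ℚ_[3])
        (v : HeightOneSpectrum (𝓞 K)) (κ : ZpExtension K 3) (γ : absoluteGaloisGroup K)
        [Fact (κ.IsTopGenerator γ)] (P : (W.baseChange K).toAffine.Point),
      W.conductorNorm ℤ = N → IsImaginaryQuadratic K →
      SatisfiesHeegnerHypothesis N K → ((Ideal.span {(3 : ℤ)}).primesOver (𝓞 K)).ncard = 2 →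
      ((3 : ℕ) : 𝓞 K) ∈ v.asIdeal →
      (∀ (w' : InfinitePlace K) (k : 𝓞 K), k ∈ v.asIdeal ↔ ‖ι'.symm (w'.embedding (k : K))‖ < 1) →
      κ.IsAnticyclotomic →
      WeierstrassCurve.Affine.Point.map w.embedding.toRatAlgHom P = heegnerPointComplex Dt H →
      (∀ k : 𝓞 K, k ∈ v.asIdeal ↔ ‖e (k : K)‖ < 1) →
      ∃ (ΩK : ℂ) (Ωp : (unrIntegers 3)ˣ) (C : ℂ_[3]) (L : UnrSeries 3),
        ΩK ≠ 0 ∧ C ≠ 0 ∧ IsBDPLFunctionUpTo C ι' v κ γ Dt.f ΩK ((Ωp : unrIntegers 3) : ℂ_[3]) L ∧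
        ∃ u : ℂ_[3], u ≠ 0 ∧ L.HasValueAt 0
          (u * algebraMap ℚ_[3] ℂ_[3] (((Dt.c : ℚ_[3])⁻¹) ^ 2 *
              (1 - (W.LFunction 3 : ℚ_[3]) * (3 : ℚ_[3])⁻¹ +
                (if (3 : ℕ) ∣ N then 0 else (3 : ℚ_[3])⁻¹)) ^ 2 *
              (padicLogOmega W 3 e P) ^ 2))) :
    ThreeAdicBDPValueAtOneUpTo := by
  intro W _ _ hj ι' K _ _ N _ Dt H w e v κ γ hγ P hN hK hHN hsplit hv3 hι' hκ hP he ΩK' Ωp' C' L' hΩK'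
    hC' hL'
  -- the reference ♯ frame at the same `ι'`, WITH its value at `𝟙`
  obtain ⟨ΩK, Ωp, C, L, hΩK, hC, hL, u, hu0, hu⟩ :=
    hEV W hj ι' K N Dt H w e v κ γ P hN hK hHN hsplit hv3 hι' hκ hP he
  have hΩp : ((Ωp : unrIntegers 3) : ℂ_[3]) ≠ 0 := by
    rw [Ne, ZeroMemClass.coe_eq_zero]
    exact Units.ne_zero Ωp
  have hΩp' : ((Ωp' : unrIntegers 3) : ℂ_[3]) ≠ 0 := by
    rw [Ne, ZeroMemClass.coe_eq_zero]
    exact Units.ne_zero Ωp'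
  -- the character supply at `(K, ι', κ, γ)` — a tree theorem at every prime
  obtain ⟨m, x₀, φ, φ', r, r', hm, -, hxlim, hunr, hinf, hr, hrκ, hval, hunr', hinf', hr', hrκ',
    hval'⟩ := characterSupplyAt (p := 3) K ι' κ γ hK hκ hγ.out
  -- LEMMA R in the ♯ frame: `[T⁰]𝓛' = (C'/C)·[T⁰]𝓛`
  have key : ((PowerSeries.constantCoeff L' : unrIntegers 3) : ℂ_[3]) =
      C' / C * ((PowerSeries.constantCoeff L : unrIntegers 3) : ℂ_[3]) :=
    coe_constantCoeff_eq_mul_of_isBDPLFunctionUpTo_of_supply K N ι' v κ γ Dt.f ΩK ΩK' _ _ C C' L L'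
      m x₀ φ φ' r r' hm hxlim hunr hinf hr hrκ hval hunr' hinf' hr' hrκ' hval' hΩK hΩK' hΩp hΩp' hC
      hC' hL hL'
  refine ⟨C' / C * u, mul_ne_zero (div_ne_zero hC' hC) hu0, ?_⟩
  have hval0 : ((PowerSeries.constantCoeff L : unrIntegers 3) : ℂ_[3]) =
      u * algebraMap ℚ_[3] ℂ_[3] (((Dt.c : ℚ_[3])⁻¹) ^ 2 *
        (1 - (W.LFunction 3 : ℚ_[3]) * (3 : ℚ_[3])⁻¹ +
          (if (3 : ℕ) ∣ N then 0 else (3 : ℚ_[3])⁻¹)) ^ 2 *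
        (padicLogOmega W 3 e P) ^ 2) :=
    (UnrSeries.eq_constantCoeff_of_hasValueAt_zero hu).symm
  have h := L'.hasValueAt_zero
  rw [key, hval0, ← mul_assoc] at h
  exact h

end Summit.BirchSwinnertonDyer.BirchSwinnertonDyer.Theorems.MordellShaFreeCutThreeAdicBDPValueRigiditySupplied

end
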